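import Literature.Probability.Percolation.SlabCircuitGlueSurgery
import HarnessLib

/-!
# Newman–Tassion–Wu 2017, §4 (proof of Theorem 2.4) — the geometry of the gluing lemma for
# invasion, I: the inside `R` of the minimal circuit and its vertex boundary `∂R`

Topic: `Literature/Probability/Percolation`.  Deterministic (configuration-free) geometry used in
the proof of NTW's Lemma 4.1 ("gluing lemma for invasion", *Critical percolation and the minimal
spanning tree in slabs*, CPAM 70 (2017) = arXiv:1512.09107, §4.1, pp. 19–21), in the vocabulary of
the tree's NTW §3 port (`slab 3 k`, `planar`, `ht`, `slabLift`, `sqBox`, `NTW17.annulus`,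
`NTW17.IsOpenCircuit`, `NTW17.Surrounds`, `NTW17.Near`).  For a vertex list `Γ` of the slab (the
minimal open circuit `Γ_min` of an annulus `Ā_{n,2n}` surrounding the origin):

* `NTW17.insideP k Γ` / `NTW17.inside k Γ` — NTW's `R(ω)`: "the connected component containing `0`
  in `{w ∈ S_k : dist(w̄, Γ_min(ω)) ≥ 1}`" (p. 20).  Since `dist(w̄, Γ_min) ≥ 1` says that the COLUMN
  of `w` contains no vertex of `Γ_min`, `R` is the lift of the planar set `insideP` of points of `ℤ²`
  joined to the origin by a lattice walk avoiding the projections of the vertices of `Γ`.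
* `NTW17.insideBdry k Γ` — the vertex boundary `∂R` ("the set of vertices in `U` with a neighbor
  in `S_k ∖ U`", §2.3); `NTW17.insideInt k Γ = R ∖ ∂R`.
* PROVED: `B̄_m ⊆ R` when `Γ` avoids the columns over `B_m` (`slabLift_sqBox_subset_inside`);
  **`R ⊆ B̄_N` when `Γ` is an open circuit of `Ā_{m,N}` surrounding the origin**
  (`insideP_subset_sqBox`, from the blocking property `exists_mem_support_of_winding_ne_zero` of
  `SlabAnnulusCircuits.lean` — the discrete Jordan curve theorem in winding-number form), hence `R`
  is finite (`inside_finite`); a vertex of `∂R` has its column adjacent to a column of `Γ`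
  (`exists_planarAdj_of_mem_insideBdry`: NTW's "there exists `z′ ∈ Γ_min` such that
  `dist(z̄, z̄′) = 1`"); a neighbour of a vertex of `R ∖ ∂R` is in `R`; the origin (and every vertex
  over `B_m` when the columns over `B_{m+1}` avoid `Γ`) lies in `R ∖ ∂R`.

What is NOT here: the landing column, the plus cylinder and the connectors `Γ_z`, `Γ_w`
(`SlabMSFConnector.lean`); the invasion, the surgery, Lemma 4.2, probabilities (later files).

## Sources

* C. M. Newman, V. Tassion, W. Wu, *Critical percolation and the minimal spanning tree in slabs*,
  Comm. Pure Appl. Math. 70 (2017) 2084–2120 = arXiv:1512.09107: §2.3 (notation `B_n`, `∂U`, `z̄`),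
  §4.1, proof of Lemma 4.1 (the sets `R(ω)`, `∂R`, the vertex `z′`), pp. 19–21 [NewmanTassionWu2017].
* H. Kesten, *Percolation theory for mathematicians*, Birkhäuser 1982, §2.2 (winding numbers; the
  tree's `PlanarDuality.lean` / `SlabAnnulusCircuits.lean`) [KestenPTM1982].
-/

noncomputable section

namespace Literature.Probability.Percolation

open MeasureTheory LatticeModels SimpleGraph

namespace NTW17

variable (k : ℕ)

/-! ## The inside of a circuit and its boundary -/

/-- **The planar inside of `Γ`**: the points of `ℤ²` joined to the origin by a lattice walk none of
whose vertices is the projection of a vertex of `Γ` (so that `R(ω)`, "the connected component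
containing `0` in `{w ∈ S_k : dist(w̄, Γ_min(ω)) ≥ 1}`", is its lift).
[cite: NewmanTassionWu2017, §4.1 (proof of Lemma 4.1, the set R(ω))] -/
def insideP (Γ : List (slab 3 k)) : Set (ℤ × ℤ) :=
  {q | ∃ W : (zdGraph 2).Walk (ts ((0 : ℤ), (0 : ℤ))) (ts q),
    ∀ x ∈ W.support, ∀ g ∈ Γ, ts (planar k g) ≠ x}

/-- **`R(ω)`**: "the connected component containing `0` in `{w ∈ S_k : dist(w̄, Γ_min(ω)) ≥ 1}`" —
the slab vertices over the planar inside of `Γ`. [cite: NewmanTassionWu2017, §4.1 (proof of Lemma 4.1, R(ω))] -/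
def inside (Γ : List (slab 3 k)) : Set (slab 3 k) := slabLift k (insideP k Γ)

/-- **`∂R`**, the vertex boundary of `R` ("the set of vertices in `U` with a neighbor in `S_k ∖ U`").
[cite: NewmanTassionWu2017, §2.3 (vertex-boundary ∂U) and §4.1 (∂R)] -/
def insideBdry (Γ : List (slab 3 k)) : Set (slab 3 k) :=
  {w | w ∈ inside k Γ ∧ ∃ w', w' ∉ inside k Γ ∧ (slabGraph 3 k).Adj w w'}

/-- `R ∖ ∂R`, the vertices of `R` all of whose neighbours lie in `R`.
[cite: NewmanTassionWu2017, §4.1 (proof of Lemma 4.1, R and ∂R)] -/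
def insideInt (Γ : List (slab 3 k)) : Set (slab 3 k) := inside k Γ \ insideBdry k Γ

variable {k}

/-- Membership in `R` is a property of the column. [cite: NewmanTassionWu2017, §4.1 (R(ω) is a union of columns)] -/
theorem mem_inside_iff {Γ : List (slab 3 k)} {w : slab 3 k} : w ∈ inside k Γ ↔ planar k w ∈ insideP k Γ :=
  Iff.rfl

/-- A point of the planar inside is not the projection of a vertex of `Γ`.
[cite: NewmanTassionWu2017, §4.1 (dist(w̄, Γ_min) ≥ 1 on R)] -/
theorem not_near_of_mem_insideP {Γ : List (slab 3 k)} {q : ℤ × ℤ} (h : q ∈ insideP k Γ) :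
    ¬ Near k Γ 0 q := by
  obtain ⟨W, hW⟩ := h
  intro hn
  obtain ⟨g, hg, hgq⟩ := near_zero_iff.1 hn
  exact hW _ W.end_mem_support g hg (by rw [hgq])

/-- No vertex of `Γ` lies in `R`. [cite: NewmanTassionWu2017, §4.1 (dist(w̄, Γ_min) ≥ 1 on R)] -/
theorem not_mem_inside_of_mem {Γ : List (slab 3 k)} {g : slab 3 k} (hg : g ∈ Γ) : g ∉ inside k Γ :=
  fun h => not_near_of_mem_insideP h (near_zero_iff.2 ⟨g, hg, rfl⟩)

/-- The planar inside is closed under lattice steps to points off the columns of `Γ`.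
[cite: NewmanTassionWu2017, §4.1 (R(ω) is a connected component)] -/
theorem mem_insideP_of_planarAdj {Γ : List (slab 3 k)} {q q' : ℤ × ℤ} (hq : q ∈ insideP k Γ)
    (hadj : planarAdj q q') (hq' : ¬ Near k Γ 0 q') : q' ∈ insideP k Γ := by
  obtain ⟨W, hW⟩ := hq
  refine ⟨W.concat (adj_ts_of_planarAdj hadj), fun x hx g hg => ?_⟩
  rw [Walk.support_concat, List.mem_append, List.mem_singleton] at hx
  rcases hx with hx | rfl
  · exact hW x hx g hg
  · intro h
    exact hq' (near_zero_iff.2 ⟨g, hg, ts_injective h⟩)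

/-- A box about the origin whose columns contain no vertex of `Γ` lies in the planar inside (boxes
are lattice-connected). [cite: NewmanTassionWu2017, §4.1 (0 ∈ R; B̄_{n_i} ⊆ R)] -/
theorem sqBox_subset_insideP {Γ : List (slab 3 k)} {m : ℕ}
    (hΓ : ∀ g ∈ Γ, planar k g ∉ sqBox ((0 : ℤ), (0 : ℤ)) m) : sqBox ((0 : ℤ), (0 : ℤ)) m ⊆ insideP k Γ := by
  intro q hq
  obtain ⟨W, hW⟩ := exists_walk_in_sqBox (mem_sqBox_self _ m) hq
  refine ⟨W, fun x hx g hg h => ?_⟩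
  obtain ⟨v, hv, rfl⟩ := hW x hx
  exact hΓ g hg (by rwa [ts_injective h])

/-- The origin lies in the planar inside as soon as no vertex of `Γ` lies over it.
[cite: NewmanTassionWu2017, §4.1 (0 ∈ R)] -/
theorem zero_mem_insideP {Γ : List (slab 3 k)} (h : ¬ Near k Γ 0 ((0 : ℤ), (0 : ℤ))) :
    ((0 : ℤ), (0 : ℤ)) ∈ insideP k Γ := by
  refine ⟨Walk.nil, fun x hx g hg hgx => ?_⟩
  rw [Walk.support_nil, List.mem_singleton] at hx
  subst hx
  exact h (near_zero_iff.2 ⟨g, hg, ts_injective hgx⟩)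

/-- **`R ⊆ B̄_N`: the inside of a surrounding circuit is bounded** (lattice configurations).  If `Γ`
is an open circuit of `Ā_{m,N}` whose projection has nonzero winding number about the origin, every
lattice walk from the origin to a point outside `B_N` meets the projection of `Γ` (the blocking
property of `SlabAnnulusCircuits.lean`), so the planar inside lies in `B_N`.
[cite: NewmanTassionWu2017, §4.1 (R(ω) ⊆ B̄_{2n_i})] [cite: KestenPTM1982, §2.2] -/
theorem insideP_subset_sqBox {ω : BondConfig (slab 3 k)} (hω : ω ⊆ (slabGraph 3 k).edgeSet)
    {Γ : List (slab 3 k)} {m N : ℕ}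
    (hΓ : IsOpenCircuit k ω (slabLift k (annulus ((0 : ℤ), (0 : ℤ)) m N)) Γ)
    (hs : Surrounds k ((0 : ℤ), (0 : ℤ)) Γ) :
    insideP k Γ ⊆ sqBox ((0 : ℤ), (0 : ℤ)) N := by
  intro q hq
  obtain ⟨W, hW⟩ := hq
  by_contra hqN
  obtain ⟨a, P, hPs, hPw⟩ := exists_closedWalk_of_circuit hω hΓ
  have hP : ∀ z ∈ P.support, (z 0, z 1) ∈ annulus ((0 : ℤ), (0 : ℤ)) m N := by
    intro z hz
    obtain ⟨v, hv, rfl⟩ := hPs z hz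
    have := hΓ.subset v hv
    simpa [proj, ts, planar] using this
  have hw : walkWinding P (ts ((0 : ℤ), (0 : ℤ))) ≠ 0 := by rw [hPw]; exact hs
  have hc' : ((ts ((0 : ℤ), (0 : ℤ))) 0, (ts ((0 : ℤ), (0 : ℤ))) 1) ∈ sqBox ((0 : ℤ), (0 : ℤ)) m := by
    simpa using mem_sqBox_self ((0 : ℤ), (0 : ℤ)) m
  have hd : ((ts q) 0, (ts q) 1) ∉ sqBox ((0 : ℤ), (0 : ℤ)) N := by simpa using hqN
  obtain ⟨z, hzW, hzP⟩ := exists_mem_support_of_winding_ne_zero P hP hw W hc' hd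
  obtain ⟨v, hv, hvz⟩ := hPs z hzP
  exact hW z hzW v hv hvz

/-- `R` is finite for a surrounding open circuit of an annulus (lattice configurations).
[cite: NewmanTassionWu2017, §4.1 (R(ω) ⊆ B̄_{2n_i})] -/
theorem inside_finite {ω : BondConfig (slab 3 k)} (hω : ω ⊆ (slabGraph 3 k).edgeSet)
    {Γ : List (slab 3 k)} {m N : ℕ}
    (hΓ : IsOpenCircuit k ω (slabLift k (annulus ((0 : ℤ), (0 : ℤ)) m N)) Γ)
    (hs : Surrounds k ((0 : ℤ), (0 : ℤ)) Γ) : (inside k Γ).Finite :=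
  (slabLift_finite k (sqBox_finite _ N)).subset (slabLift_mono k (insideP_subset_sqBox hω hΓ hs))

/-- `R ⊆ B̄_N` at the level of slab vertices. [cite: NewmanTassionWu2017, §4.1 (R(ω) ⊆ B̄_{2n_i})] -/
theorem inside_subset_slabLift_sqBox {ω : BondConfig (slab 3 k)} (hω : ω ⊆ (slabGraph 3 k).edgeSet)
    {Γ : List (slab 3 k)} {m N : ℕ}
    (hΓ : IsOpenCircuit k ω (slabLift k (annulus ((0 : ℤ), (0 : ℤ)) m N)) Γ)
    (hs : Surrounds k ((0 : ℤ), (0 : ℤ)) Γ) :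
    inside k Γ ⊆ slabLift k (sqBox ((0 : ℤ), (0 : ℤ)) N) :=
  slabLift_mono k (insideP_subset_sqBox hω hΓ hs)

/-- The vertices of an open circuit of `Ā_{m,N}` lie off the columns over `B_m` (for `m`… any `m`:
the annulus excludes `B_m`), so `B̄_m ⊆ R`. [cite: NewmanTassionWu2017, §4.1 (B̄_{n_i} ⊆ R(ω))] -/
theorem slabLift_sqBox_subset_inside {ω : BondConfig (slab 3 k)} {Γ : List (slab 3 k)} {m N : ℕ}
    (hΓ : IsOpenCircuit k ω (slabLift k (annulus ((0 : ℤ), (0 : ℤ)) m N)) Γ) :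
    slabLift k (sqBox ((0 : ℤ), (0 : ℤ)) m) ⊆ inside k Γ := by
  refine slabLift_mono k (sqBox_subset_insideP fun g hg hgm => ?_)
  have := hΓ.subset g hg
  rw [mem_slabLift_iff] at this
  exact (disjoint_annulus_sqBox _ m N).le_bot ⟨this, hgm⟩

/-- **A boundary vertex of `R` has its column adjacent to a column of `Γ`** ("by definition, there
exists `z′ ∈ Γ_min` such that `dist(z̄, z̄′) = 1`"). [cite: NewmanTassionWu2017, §4.1 (proof of Lemma 4.1, the vertex z′)] -/
theorem exists_planarAdj_of_mem_insideBdry {Γ : List (slab 3 k)} {w : slab 3 k}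
    (hw : w ∈ insideBdry k Γ) : ∃ g ∈ Γ, planarAdj (planar k w) (planar k g) := by
  obtain ⟨hwR, w', hw'R, hadj⟩ := hw
  rcases (slab_adj_iff w w').1 hadj with ⟨-, hpa⟩ | ⟨hpe, -⟩
  · by_cases hn : Near k Γ 0 (planar k w')
    · obtain ⟨g, hg, hgw'⟩ := near_zero_iff.1 hn
      exact ⟨g, hg, by rwa [hgw']⟩
    · exact absurd (mem_insideP_of_planarAdj hwR hpa hn) hw'R
  · exact absurd (show w' ∈ inside k Γ by rw [mem_inside_iff, ← hpe]; exact hwR) hw'R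

/-- A neighbour of a vertex of `R ∖ ∂R` lies in `R`. [cite: NewmanTassionWu2017, §4.1 (R and ∂R)] -/
theorem mem_inside_of_adj_of_mem_insideInt {Γ : List (slab 3 k)} {a b : slab 3 k}
    (ha : a ∈ insideInt k Γ) (hab : (slabGraph 3 k).Adj a b) : b ∈ inside k Γ := by
  by_contra hb
  exact ha.2 ⟨ha.1, b, hb, hab⟩

/-- `R ∖ ∂R ⊆ R`. [cite: NewmanTassionWu2017, §4.1 (R and ∂R)] -/
theorem insideInt_subset (Γ : List (slab 3 k)) : insideInt k Γ ⊆ inside k Γ := fun _ h => h.1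

/-- `∂R ⊆ R`. [cite: NewmanTassionWu2017, §4.1 (R and ∂R)] -/
theorem insideBdry_subset (Γ : List (slab 3 k)) : insideBdry k Γ ⊆ inside k Γ := fun _ h => h.1

/-- A vertex of `R` whose planar neighbours all lie in the planar inside is in `R ∖ ∂R`.
[cite: NewmanTassionWu2017, §4.1 (R and ∂R)] -/
theorem mem_insideInt_of_forall_planarAdj {Γ : List (slab 3 k)} {w : slab 3 k} (hw : w ∈ inside k Γ)
    (h : ∀ q, planarAdj (planar k w) q → q ∈ insideP k Γ) : w ∈ insideInt k Γ := by
  refine ⟨hw, fun ⟨_, w', hw'R, hadj⟩ => hw'R ?_⟩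
  rcases (slab_adj_iff w w').1 hadj with ⟨-, hpa⟩ | ⟨hpe, -⟩
  · exact h _ hpa
  · rw [mem_inside_iff, ← hpe]; exact hw

/-- **`0 ∈ R ∖ ∂R`** as soon as the columns over `B_1` avoid `Γ` (e.g. `Γ ⊆ Ā_{m,N}`, `m ≥ 1`).
[cite: NewmanTassionWu2017, §4.1 (the invasion from 0 starts inside R)] -/
theorem slabOrigin_mem_insideInt {Γ : List (slab 3 k)}
    (h1 : sqBox ((0 : ℤ), (0 : ℤ)) 1 ⊆ insideP k Γ) : slabOrigin 3 k ∈ insideInt k Γ := by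
  have h0 : planar k (slabOrigin 3 k) = ((0 : ℤ), (0 : ℤ)) := rfl
  refine mem_insideInt_of_forall_planarAdj (by rw [mem_inside_iff, h0]; exact h1 (mem_sqBox_self _ 1))
    fun q hq => h1 ?_
  rw [h0] at hq
  exact mem_sqBox_one_of_planarAdj hq

/-- A vertex over `B_m` lies in `R ∖ ∂R` when the columns over `B_{m+1}` avoid `Γ`.
[cite: NewmanTassionWu2017, §4.1 (x ∈ B̄_{m_{i₀}} lies inside R)] -/
theorem mem_insideInt_of_planar_mem_sqBox {Γ : List (slab 3 k)} {m : ℕ} {w : slab 3 k}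
    (hw : planar k w ∈ sqBox ((0 : ℤ), (0 : ℤ)) m)
    (h1 : sqBox ((0 : ℤ), (0 : ℤ)) (m + 1) ⊆ insideP k Γ) : w ∈ insideInt k Γ := by
  refine mem_insideInt_of_forall_planarAdj (h1 (sqBox_mono _ (Nat.le_succ m) hw)) fun q hq => h1 ?_
  exact mem_sqBox_add hw (mem_sqBox_one_of_planarAdj hq)

end NTW17

end Literature.Probability.Percolation
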